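import Literature.NumberTheory.NumberFields.HerbrandStickelberger
import Literature.NumberTheory.NumberFields.ImaginaryAbelianFieldOddChiClassNumberBridge
import Mathlib.NumberTheory.NumberField.Cyclotomic.Galois
import Mathlib.FieldTheory.Galois.Infinite
import Mathlib.FieldTheory.IsSepClosed
import Mathlib.Data.Nat.Choose.Dvd
import HarnessLib

/-!
# The Herbrand direction of Mazur–Wiles' Theorem 2 for EVERY abelian `K`, unconditionally: from the `Γ_ℚ`-dictionary `ψ(τ̄) = χ(χ_f(τ))` to `e_ψ(ℤ_p ⊗ Cl K) = 0` when `‖B_{1,χ⁻¹}‖_p = 1` (Lang Ch. 1 §3 Thm. 3.1 + Cor. 3; Washington Thm. 6.10)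

Topic `Literature/NumberTheory/NumberFields`, namespace `Literature.NumberTheory.NumberFields.HerbrandStickelberger`.
THEOREMS ONLY (no definition, no named fact, no `sorry`, no instance, no notation; D-0014 ∕ D-0026: net debt 0).
Sequel BY NAME of `HerbrandStickelberger.lean` (`classGroupChiComponent_eq_bot_of_norm_bernoulliSum_eq_one`: the
Stickelberger annihilation of `e_ψ(ℤ_p ⊗ Cl K)` for `K ⊇ K₁ ⊆ ℚ(μ_f)` given as data) and of
`ImaginaryAbelianFieldOddChiClassNumber.lean` ∕ `…Bridge.lean` (the named fact
`MazurWiles1984.thm2_card_oddChiClassGroup_eq_bernoulli` and its consumers' root lemma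
`classGroupChiComponent_eq_bot_of_norm_bernoulli_eq_one (h : MW) …`; `bernoulliOnePrim_inv_eq_generalizedBernoulli`).
Companion of `ImaginaryAbelianClassGroupOddPartBernoulliProofs.lean`, which proves the same direction for the full
cyclotomic field `K = ℚ(μ_f)` only («for a general abelian `K` … nothing is claimed» there); the present file does
the GENERAL abelian `K` with `p ∤ [K:ℚ]`.

## The main theorem and why it is a drop-in

**`classGroupChiComponent_eq_bot_of_norm_bernoulli_eq_one_stickelberger`** has EXACTLY the signature of the root
lemma `Literature.NumberTheory.NumberFields.classGroupChiComponent_eq_bot_of_norm_bernoulli_eq_one` MINUS its first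
hypothesis `(h : MazurWiles1984.thm2_card_oddChiClassGroup_eq_bernoulli)`: `p ≠ 2`, `K/ℚ` abelian (`IsAbelianGalois`,
`K : Type`) with `p ∤ [K:ℚ]`, `χ` a primitive odd `ℚ_p`-valued Dirichlet character mod `f` with «`χ ≠ ω`»
(`¬ ∀ a, p ∤ a → ‖χ(a) − a‖ < 1`), `ψ : Gal(K/ℚ) →* ℤ_pˣ` with `ψ(τ̄) = χ(χ_f(τ))` for all `τ ∈ Γ_ℚ`
(`absGaloisQuot`, `modNCyclotomicCharacter`), `‖bernoulliOnePrim χ⁻¹‖ = 1` ⟹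
`classGroupChiComponent ℚ K p ψ = ⊥`. Every use of the Mazur–Wiles named fact in the BSD cell's Herbrand chain
(`Summits/BirchSwinnertonDyer/BirchSwinnertonDyer/Theorems/PrintCFramBottomClassIndexLawFiveLeHerbrand*`) factors
through that root lemma, so each of those theorems has an `hMW`-free twin by replacing the root call.

## Proof (Lang's road, for a subfield)

1. `K₁ := K^{ker ψ}` (an intermediate field of `K`, Galois over `ℚ` since `Gal(K/ℚ)` is abelian) EMBEDS in
   `M = ℚ(μ_f)` (`CyclotomicField f ℚ`): `exists_absEmbedding_eq_of_mem_fixedField` — an element of `Γ_ℚ` fixing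
   the copy of `M` in `ℚ̄` has `χ_f = 1`, hence `ψ(τ̄) = χ(1) = 1`, `τ̄ ∈ ker ψ` fixes `K₁`; the Galois
   correspondence for `ℚ̄/ℚ` (Mathlib `InfiniteGalois.fixedField_fixingSubgroup`) puts `e_K(K₁)` inside `e_M(M)`.
   (This is the sharp Kronecker–Weber statement «the field of `ψ` lies in `ℚ(μ_{f_χ})`», free in this currency.)
2. Along the fibres of `Gal(K/ℚ) → Gal(K₁/ℚ)`, `ψ = χ ∘ c` (`c : Gal(M/ℚ) ≅ (ℤ/f)ˣ`): lift `σ ∈ Gal(M/ℚ)` to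
   `τ ∈ Γ_ℚ`, read `χ_f(τ) = c(σ)` off `ζ_f ∈ ℚ̄`, and `g⁻¹τ̄ ∈ ker ψ` when `g|_{K₁} = σ|_{K₁} = τ̄|_{K₁}`.
3. Lang's Lemma 1 (ii): `exists_unit_norm_natCast_sub_apply_eq_one` — a unit `b` mod `f` with `b − χ(b) ∈ ℤ_pˣ`
   (for `p ∤ f`, `b = f − 1`; for `p ∣ f`, otherwise `χ` kills the units `≡ 1 (mod p)` — here one needs that a root
   of unity of `ℚ_p` congruent to `1` is `1` for `p` odd, of ANY order: `eq_one_of_pow_eq_one_of_norm_sub_one_lt`,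
   via `eq_zero_of_one_add_pow_prime_eq_one` (`ζ_p ∉ ℚ_p`) and `eq_zero_of_one_add_pow_eq_one_of_not_dvd` — so `χ`
   factors through `p`, `f = p`, contradicting «`χ ≠ ω`»).
4. `sum_units_val_mul_inv_div_eq_bernoulliOnePrim`: `B_{1,χ⁻¹} = (1/f)Σ_{u ∈ (ℤ/f)ˣ} u χ(u)⁻¹`; and the companion's
   `classGroupChiComponent_eq_bot_of_norm_bernoulliSum_eq_one` concludes.

HONEST FRAMING: this is Stickelberger–Herbrand, not Mazur–Wiles; the converse direction (Ribet ∕ Mazur–Wiles proper,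
`#e_ψ = p^{v(B)}`) is not touched and the named fact keeps its debt. Typed for the BSD cell `bsd-print-cfram` (crux
`stmt-BirchSwinnertonDyer-20372`, line `eisenstein-resource-bdp-line`, Stub H): BSD is not proved by any of this.

## References

* [Lang1990] S. Lang, *Cyclotomic Fields I and II*, GTM 121 (1990), Ch. 1 §3 Lemma 1, Thm. 3.1, Cor. 1–3.
* [Washington1997] L. C. Washington, *Introduction to Cyclotomic Fields*, 2nd ed. (1997), Ch. 3 (fields of Dirichlet
  characters), §4.1 (`B_{1,χ}`), §5.1 (roots of unity of `ℚ_p`), Thm. 6.10, §6.3.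
* [Solomon1990] D. Solomon, Ann. Inst. Fourier 40 (1990), §II.1 Lemma II.1, Rem. II.1 (a) p. 472.
* [MazurWiles1984] B. Mazur, A. Wiles, Invent. Math. 76 (1984), Thm. 2 (p. 216) — NOT used, NOT discharged.
-/

noncomputable section

open Finset

namespace Literature.NumberTheory.NumberFields.HerbrandStickelberger

open Literature.NumberTheory.EllipticCurves Literature.NumberTheory.LFunctions

variable {p : ℕ} [hp : Fact p.Prime]

/-! ### §1 Roots of unity of `ℚ_p` congruent to `1` are trivial (`p` odd) -/

/-- `‖x‖ ≤ 1` when `‖x − 1‖ < 1`. [folklore] -/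
private theorem norm_le_one_of_norm_sub_one_lt {x : ℚ_[p]} (hx : ‖x - 1‖ < 1) : ‖x‖ ≤ 1 := by
  have h := IsUltrametricDist.norm_add_le_max (x - 1) (1 : ℚ_[p])
  rw [sub_add_cancel, norm_one] at h
  exact h.trans (max_le hx.le le_rfl)

/-- `‖Σ_{j<i} x^j‖ ≤ 1` for `‖x‖ ≤ 1`. [folklore] -/
private theorem norm_geom_sum_le_one {x : ℚ_[p]} (hx : ‖x‖ ≤ 1) (i : ℕ) :
    ‖∑ j ∈ range i, x ^ j‖ ≤ 1 :=
  IsUltrametricDist.norm_sum_le_of_forall_le_of_nonneg zero_le_one fun j _ => by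
    rw [norm_pow]; exact pow_le_one₀ (norm_nonneg _) hx

/-- `‖xⁱ − 1‖ ≤ ‖x − 1‖` for `‖x − 1‖ < 1` (`xⁱ − 1 = (x − 1)Σ_{j<i} xʲ`). [folklore] -/
private theorem norm_pow_sub_one_le {x : ℚ_[p]} (hx : ‖x - 1‖ < 1) (i : ℕ) :
    ‖x ^ i - 1‖ ≤ ‖x - 1‖ := by
  rw [← geom_sum_mul, norm_mul]
  exact mul_le_of_le_one_left (norm_nonneg _) (norm_geom_sum_le_one (norm_le_one_of_norm_sub_one_lt hx) i)

/-- **A root of unity of order prime to `p` congruent to `1` is `1`**: if `(1 + y)^m = 1`, `p ∤ m` and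
`‖y‖ < 1` then `y = 0` (`Σ_{i<m} (1+y)ⁱ ≡ m` is a unit). [cite: Washington1997, §5.1 (roots of unity in ℤ_p; Prop. 5.? / Lemma on μ_{p−1})] -/
theorem eq_zero_of_one_add_pow_eq_one_of_not_dvd {y : ℚ_[p]} {m : ℕ} (hm : ¬ p ∣ m) (hy : ‖y‖ < 1)
    (h : (1 + y) ^ m = 1) : y = 0 := by
  have hx : ‖(1 + y) - 1‖ < 1 := by rwa [add_sub_cancel_left]
  set S : ℚ_[p] := ∑ i ∈ range m, (1 + y) ^ i with hS
  have hSy : S * y = 0 := by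
    have := geom_sum_mul (1 + y) m
    rw [add_sub_cancel_left, h, sub_self] at this
    exact this
  -- `‖S − m‖ < 1`, `‖m‖ = 1`
  have hSm : ‖S - m‖ < 1 := by
    have hrw : S - m = ∑ i ∈ range m, ((1 + y) ^ i - 1) := by
      rw [sum_sub_distrib, sum_const, card_range, nsmul_eq_mul, mul_one]
    rw [hrw]
    refine lt_of_le_of_lt (IsUltrametricDist.norm_sum_le_of_forall_le_of_nonneg (norm_nonneg y)
      fun i _ => ?_) hy
    exact (norm_pow_sub_one_le hx i).trans (by rw [add_sub_cancel_left])
  have hmn : ‖(m : ℚ_[p])‖ = 1 := by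
    rw [Padic.norm_natCast_eq_one_iff]
    exact (Nat.Prime.coprime_iff_not_dvd hp.out).mpr hm
  have hS1 : ‖S‖ = 1 := by
    have h' := IsUltrametricDist.norm_add_eq_max_of_norm_ne_norm (x := S - m) (y := (m : ℚ_[p]))
      (by rw [hmn]; exact hSm.ne)
    rw [sub_add_cancel, hmn] at h'
    rw [h', max_eq_right hSm.le]
  have hS0 : S ≠ 0 := fun h0 => by rw [h0, norm_zero] at hS1; exact zero_ne_one hS1
  exact (mul_eq_zero.mp hSy).resolve_left hS0

/-- **`ℚ_p` has no `p`-th roots of unity congruent to `1` except `1` (`p` odd)**: if `(1 + y)^p = 1` and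
`‖y‖ < 1` then `y = 0` — in `(1+y)^p − 1 = py + Σ_{k≥2} C(p,k)yᵏ` the term `py` strictly dominates
(`‖y‖ ≤ p⁻¹`, `p ∣ C(p,k)` for `2 ≤ k ≤ p−1`, and `‖yᵖ‖ ≤ p^{−(p−1)}‖y‖ < p⁻¹‖y‖` as `p ≥ 3`).
[cite: Washington1997, §5.1 (ζ_p ∉ ℚ_p for odd p; roots of unity of ℚ_p)] -/
theorem eq_zero_of_one_add_pow_prime_eq_one (hp2 : p ≠ 2) {y : ℚ_[p]} (hy : ‖y‖ < 1)
    (h : (1 + y) ^ p = 1) : y = 0 := by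
  by_contra hy0
  have hp3 : 3 ≤ p := by
    have := hp.out.two_le
    omega
  have hp1 : (1 : ℝ) < p := by exact_mod_cast hp.out.one_lt
  have hpinv : ‖(p : ℚ_[p])‖ = (p : ℝ)⁻¹ := Padic.norm_p
  have hypos : 0 < ‖y‖ := norm_pos_iff.mpr hy0
  -- `‖y‖ ≤ p⁻¹`
  have hyp : ‖y‖ ≤ (p : ℝ)⁻¹ := by
    have := (Padic.norm_lt_pow_iff_norm_le_pow_sub_one y 0).mp (by rwa [zpow_zero])
    rwa [zero_sub, zpow_neg, zpow_one] at this
  -- the expansion `(1+y)^p − 1 = py + Σ_{k<p−1} C(p,k+2) y^{k+2}`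
  have hexp : (1 + y) ^ p = 1 + p * y + ∑ k ∈ range (p - 1), (p.choose (k + 2) : ℚ_[p]) * y ^ (k + 2) := by
    rw [add_comm (1 : ℚ_[p]) y, add_pow]
    have hp' : p + 1 = (p - 1) + 1 + 1 := by omega
    rw [hp', sum_range_succ', sum_range_succ']
    simp only [one_pow, mul_one, pow_zero, Nat.choose_zero_right, Nat.cast_one, zero_add, pow_one,
      Nat.choose_one_right]
    ring_nf
  have hR : (p : ℚ_[p]) * y = -∑ k ∈ range (p - 1), (p.choose (k + 2) : ℚ_[p]) * y ^ (k + 2) := by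
    rw [eq_neg_iff_add_eq_zero]
    have := hexp
    rw [h] at this
    linear_combination -this
  -- every term of the remainder is `< ‖py‖ = p⁻¹‖y‖`
  have hterm : ∀ k ∈ range (p - 1), ‖(p.choose (k + 2) : ℚ_[p]) * y ^ (k + 2)‖ < (p : ℝ)⁻¹ * ‖y‖ := by
    intro k hk
    rw [mem_range] at hk
    rw [norm_mul, norm_pow]
    rcases lt_or_eq_of_le (show k + 2 ≤ p by omega) with hlt | heq
    · -- `p ∣ C(p, k+2)`
      have hdvd : p ∣ p.choose (k + 2) := hp.out.dvd_choose_self (by omega) hlt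
      obtain ⟨c, hc⟩ := hdvd
      have hC : ‖(p.choose (k + 2) : ℚ_[p])‖ ≤ (p : ℝ)⁻¹ := by
        rw [hc, Nat.cast_mul, norm_mul, hpinv]
        exact mul_le_of_le_one_right (inv_nonneg.mpr (by positivity))
          (by exact_mod_cast Padic.norm_int_le_one (c : ℤ))
      have hy2 : ‖y‖ ^ (k + 2) ≤ ‖y‖ ^ 2 :=
        pow_le_pow_of_le_one (norm_nonneg _) hy.le (by omega)
      calc ‖(p.choose (k + 2) : ℚ_[p])‖ * ‖y‖ ^ (k + 2)
          ≤ (p : ℝ)⁻¹ * ‖y‖ ^ 2 := mul_le_mul hC hy2 (by positivity) (by positivity)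
        _ < (p : ℝ)⁻¹ * ‖y‖ := by
          rw [sq, ← mul_assoc]
          exact mul_lt_of_lt_one_right (by positivity) hy
    · -- the last term `y^p`
      rw [heq, Nat.choose_self, Nat.cast_one, norm_one, one_mul]
      have hsplit : ‖y‖ ^ p = ‖y‖ ^ (p - 1) * ‖y‖ := by
        rw [← pow_succ]; congr 1; omega
      rw [hsplit]
      refine mul_lt_mul_of_pos_right ?_ hypos
      calc ‖y‖ ^ (p - 1) ≤ ((p : ℝ)⁻¹) ^ (p - 1) :=
            pow_le_pow_left₀ (norm_nonneg _) hyp _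
        _ ≤ ((p : ℝ)⁻¹) ^ 2 := pow_le_pow_of_le_one (by positivity)
            (inv_le_one_of_one_le₀ hp1.le) (by omega)
        _ < (p : ℝ)⁻¹ := by
            rw [sq]
            exact mul_lt_of_lt_one_left (by positivity) (inv_lt_one_of_one_lt₀ hp1)
  have hRlt : ‖∑ k ∈ range (p - 1), (p.choose (k + 2) : ℚ_[p]) * y ^ (k + 2)‖ < (p : ℝ)⁻¹ * ‖y‖ := by
    have hne : (range (p - 1)).Nonempty := ⟨0, by rw [mem_range]; omega⟩
    refine lt_of_le_of_lt (hne.norm_sum_le_sup'_norm _) ?_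
    rw [Finset.sup'_lt_iff]
    exact hterm
  have : ‖(p : ℚ_[p]) * y‖ = (p : ℝ)⁻¹ * ‖y‖ := by rw [norm_mul, hpinv]
  rw [hR, norm_neg] at this
  exact hRlt.ne this

/-- **A root of unity `ζ ∈ ℚ_p` with `‖ζ − 1‖ < 1` equals `1`** (`p` odd): strip the `p`-part of the order by
the previous lemma, then the prime-to-`p` part. [cite: Washington1997, §5.1 (the roots of unity of ℚ_p are μ_{p−1}, p odd)] -/
theorem eq_one_of_pow_eq_one_of_norm_sub_one_lt (hp2 : p ≠ 2) {ζ : ℚ_[p]} {n : ℕ} (hn : 0 < n)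
    (hζ : ζ ^ n = 1) (h1 : ‖ζ - 1‖ < 1) : ζ = 1 := by
  induction n using Nat.strong_induction_on generalizing ζ with
  | _ n ih =>
    by_cases hpn : p ∣ n
    · obtain ⟨m, rfl⟩ := hpn
      have hm : 0 < m := by
        rcases Nat.eq_zero_or_pos m with h0 | h0
        · subst h0; simp at hn
        · exact h0
      -- `η = ζ^m` is a `p`-th root of unity congruent to `1`
      have hη : (1 + (ζ ^ m - 1)) ^ p = 1 := by rw [add_sub_cancel, ← pow_mul, mul_comm, hζ]
      have hη1 : ‖ζ ^ m - 1‖ < 1 := lt_of_le_of_lt (norm_pow_sub_one_le h1 m) h1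
      have hm1 : ζ ^ m = 1 := sub_eq_zero.mp (eq_zero_of_one_add_pow_prime_eq_one hp2 hη1 hη)
      have hmlt : m < p * m := lt_mul_left hm hp.out.one_lt
      exact ih m hmlt hm hm1 h1
    · have := eq_zero_of_one_add_pow_eq_one_of_not_dvd hpn (y := ζ - 1) h1 (by rwa [add_sub_cancel])
      exact (sub_eq_zero.mp this)

/-! ### A unit `b` mod `f` with `b − χ(b) ∈ ℤ_pˣ`, from `χ ≠ ω` -/

section GoodUnit

variable {f : ℕ} [NeZero f]

omit [NeZero f] in
/-- The values of a Dirichlet character on units are roots of unity: `χ(u)^{φ(f)} = 1`. [folklore] -/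
private theorem pow_totient_apply_eq_one (χ : DirichletCharacter ℚ_[p] f) (u : (ZMod f)ˣ) :
    χ (u : ZMod f) ^ Nat.totient f = 1 := by
  rw [← map_pow, ← Units.val_pow_eq_pow_val, ZMod.pow_totient, Units.val_one, map_one]

/-- Hence `‖χ(u)‖ = 1`. [folklore] -/
private theorem norm_apply_coe_unit (χ : DirichletCharacter ℚ_[p] f) (u : (ZMod f)ˣ) :
    ‖χ (u : ZMod f)‖ = 1 := by
  have h := congrArg norm (pow_totient_apply_eq_one χ u)
  rw [norm_pow, norm_one] at h
  exact (pow_eq_one_iff_of_nonneg (norm_nonneg _) (Nat.totient_pos.mpr (NeZero.pos f)).ne').mp h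

/-- An odd character has level `f ≠ 1`. [folklore] -/
private theorem level_ne_one_of_odd {χ : DirichletCharacter ℚ_[p] f} (hodd : χ.Odd) : f ≠ 1 := by
  rintro rfl
  have h : χ (-1) = -1 := hodd
  rw [show (-1 : ZMod 1) = 1 from Subsingleton.elim _ _, map_one] at h
  norm_num at h

/-- **`χ ≠ ω` gives a unit `b` mod `f` with `b − χ(b)` a `p`-adic unit** (`p` odd, `χ` primitive and odd,
and — reading «`χ ≠ ω`» as in the tree — not all `a` prime to `p` have `χ(a) ≡ a (mod p)`). For `p ∤ f`,
`b = f − 1` (`χ(−1) = −1`, `b − χ(b) = f`). For `p ∣ f`: if every unit `u` had `χ(u) ≡ u`, the units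
`u ≡ 1 (mod p)` would have `χ(u) ≡ 1`, hence `χ(u) = 1` (no root of unity of `ℚ_p` is congruent to `1` but
`1`), so `χ` would factor through `p`, `f = p` by primitivity, contradicting the hypothesis. This is the
element of Lang's ideal `I_χ ∋ b − χ(b)` that is a unit for `χ ≠ ω`.
[cite: Lang1990, Ch. 1 §3 (proof of Cor. 3: «B_{1,χ̄} is a p-unit, whence 𝒞^{(p)}(χ) = 0» needs an element of I_χ prime to p)] [cite: Washington1997, §6.3] -/
theorem exists_unit_norm_natCast_sub_apply_eq_one (hp2 : p ≠ 2) {χ : DirichletCharacter ℚ_[p] f}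
    (hprim : χ.IsPrimitive) (hodd : χ.Odd)
    (hχω : ¬ ∀ a : ℤ, ¬ ((p : ℤ) ∣ a) → ‖χ (a : ZMod f) - (a : ℚ_[p])‖ < 1) :
    ∃ b : ℕ, b < f ∧ IsUnit (b : ZMod f) ∧ ‖(b : ℚ_[p]) - χ (b : ZMod f)‖ = 1 := by
  have hf1 : f ≠ 1 := level_ne_one_of_odd hodd
  have hfpos : 0 < f := NeZero.pos f
  by_cases hpf : p ∣ f
  · -- some unit `u` has `‖u − χ(u)‖ = 1`; otherwise `χ` factors through `p`
    by_contra hne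
    push Not at hne
    have hlt : ∀ u : (ZMod f)ˣ, ‖(((u : ZMod f).val : ℕ) : ℚ_[p]) - χ (u : ZMod f)‖ < 1 := by
      intro u
      have hle : ‖(((u : ZMod f).val : ℕ) : ℚ_[p]) - χ (u : ZMod f)‖ ≤ 1 := by
        rw [sub_eq_add_neg]
        refine (IsUltrametricDist.norm_add_le_max _ _).trans (max_le ?_ ?_)
        · exact_mod_cast Padic.norm_int_le_one (((u : ZMod f).val : ℕ) : ℤ)
        · rw [norm_neg]; exact (norm_apply_coe_unit χ u).le
      refine lt_of_le_of_ne hle fun h => ?_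
      exact hne (u : ZMod f).val (ZMod.val_lt _) (by rw [ZMod.natCast_zmod_val]; exact u.isUnit)
        (by rw [ZMod.natCast_zmod_val]; exact h)
    -- units `≡ 1 (mod p)` have `χ(u) = 1`
    have hker : (ZMod.unitsMap hpf).ker ≤ χ.toUnitHom.ker := by
      intro u hu
      rw [MonoidHom.mem_ker] at hu ⊢
      have hval : (((u : ZMod f).val : ℕ) : ZMod p) = 1 := by
        have := congrArg (fun x : (ZMod p)ˣ => (x : ZMod p)) hu
        simp only [ZMod.unitsMap_val, Units.val_one, ZMod.cast_eq_val] at this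
        exact this
      have h1 : ‖(((u : ZMod f).val : ℕ) : ℚ_[p]) - 1‖ < 1 := by
        have hdvd : (p : ℤ) ∣ (((u : ZMod f).val : ℕ) : ℤ) - 1 := by
          rw [← ZMod.intCast_zmod_eq_zero_iff_dvd]
          push_cast
          rw [hval, sub_self]
        have := Padic.norm_intCast_lt_one_iff (p := p) |>.mpr hdvd
        push_cast at this
        exact this
      have hχ1 : ‖χ (u : ZMod f) - 1‖ < 1 := by
        have : χ (u : ZMod f) - 1 = (χ (u : ZMod f) - (((u : ZMod f).val : ℕ) : ℚ_[p])) +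
            ((((u : ZMod f).val : ℕ) : ℚ_[p]) - 1) := by ring
        rw [this]
        refine lt_of_le_of_lt (IsUltrametricDist.norm_add_le_max _ _) (max_lt ?_ h1)
        rw [← norm_neg, neg_sub]
        exact hlt u
      have hroot := eq_one_of_pow_eq_one_of_norm_sub_one_lt hp2 (Nat.totient_pos.mpr hfpos)
        (pow_totient_apply_eq_one χ u) hχ1
      exact Units.ext (by rw [MulChar.coe_toUnitHom]; exact hroot)
    have hfac : χ.FactorsThrough p := (DirichletCharacter.factorsThrough_iff_ker_unitsMap hpf).mpr hker
    have hdvd : χ.conductor ∣ p := DirichletCharacter.conductor_dvd_of_mem_conductorSet χ hfac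
    rw [hprim] at hdvd
    have hfp : f = p := ((Nat.dvd_prime hp.out).mp hdvd).resolve_left hf1
    subst hfp
    -- now `f = p`: contradiction with `χ ≠ ω`
    apply hχω
    intro a hpa
    have hau : IsUnit (a : ZMod f) := by
      rw [ZMod.coe_int_isUnit_iff_isCoprime]
      exact (Prime.coprime_iff_not_dvd (Nat.prime_iff_prime_int.mp hp.out)).mpr hpa
    obtain ⟨u, hu⟩ := hau
    -- `‖χ(a) − a‖ ≤ max (‖χ(u) − u.val‖, ‖u.val − a‖) < 1`
    have hva : ‖(((u : ZMod f).val : ℕ) : ℚ_[f]) - (a : ℚ_[f])‖ < 1 := by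
      have hdvd : (f : ℤ) ∣ (((u : ZMod f).val : ℕ) : ℤ) - a := by
        rw [← ZMod.intCast_zmod_eq_zero_iff_dvd]
        push_cast
        rw [ZMod.natCast_zmod_val, hu, sub_self]
      have := Padic.norm_intCast_lt_one_iff (p := f) |>.mpr hdvd
      push_cast at this
      exact this
    have : χ (a : ZMod f) - (a : ℚ_[f]) = (χ (u : ZMod f) - (((u : ZMod f).val : ℕ) : ℚ_[f])) +
        ((((u : ZMod f).val : ℕ) : ℚ_[f]) - (a : ℚ_[f])) := by rw [hu]; ring
    rw [this]
    refine lt_of_le_of_lt (IsUltrametricDist.norm_add_le_max _ _) (max_lt ?_ hva)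
    rw [← norm_neg, neg_sub]
    exact hlt u
  · refine ⟨f - 1, Nat.sub_lt hfpos one_pos, ?_, ?_⟩
    · have : ((f - 1 : ℕ) : ZMod f) = -1 := by
        rw [Nat.cast_sub (by omega), Nat.cast_one, ZMod.natCast_self, zero_sub]
      rw [this]; exact isUnit_one.neg
    · have h1 : ((f - 1 : ℕ) : ZMod f) = -1 := by
        rw [Nat.cast_sub (by omega), Nat.cast_one, ZMod.natCast_self, zero_sub]
      have hχ : χ ((f - 1 : ℕ) : ZMod f) = -1 := by rw [h1]; exact hodd
      rw [hχ, Nat.cast_sub (by omega), Nat.cast_one, sub_neg_eq_add, sub_add_cancel,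
        Padic.norm_natCast_eq_one_iff]
      exact (Nat.Prime.coprime_iff_not_dvd hp.out).mpr hpf

end GoodUnit

section BernoulliForm

variable {f : ℕ} [NeZero f]

/-- A sum over `ℤ/f` of a function vanishing off the units is the sum over `(ℤ/f)ˣ`. [folklore] -/
private theorem sum_eq_sum_units {M : Type*} [AddCommMonoid M] (F : ZMod f → M)
    (hF : ∀ j : ZMod f, ¬ IsUnit j → F j = 0) :
    ∑ j : ZMod f, F j = ∑ u : (ZMod f)ˣ, F (u : ZMod f) := by
  classical
  rw [← Finset.sum_filter_of_ne (p := fun j : ZMod f => IsUnit j) (fun j _ hj => by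
    by_contra h; exact hj (hF j h))]
  have himg : (univ.filter fun j : ZMod f => IsUnit j) = univ.image (fun u : (ZMod f)ˣ => (u : ZMod f)) := by
    ext j
    simp only [mem_filter, mem_univ, true_and, mem_image]
    exact ⟨fun ⟨u, hu⟩ => ⟨u, hu⟩, fun ⟨u, hu⟩ => ⟨u, hu⟩⟩
  rw [himg, Finset.sum_image fun u _ v _ h => Units.ext h]

/-- **`B_{1,χ⁻¹} = (1/f) Σ_{u ∈ (ℤ/f)ˣ} u·χ(u)⁻¹`** for a primitive non-trivial `χ` mod `f` (the tree's
`bernoulliOnePrim χ⁻¹ = generalizedBernoulli 1 χ⁻¹ = (Σ_j χ⁻¹(j) j)/f`, with `χ⁻¹` vanishing off the units).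
[cite: Washington1997, §4.1 (B_{1,χ} = (1/f)Σ χ(a) a for χ ≠ 1)] [cite: Lang1990, Ch. 1 §2 (B_{1,χ})] -/
theorem sum_units_val_mul_inv_div_eq_bernoulliOnePrim {χ : DirichletCharacter ℚ_[p] f}
    (hprim : χ.IsPrimitive) (hχ1 : χ ≠ 1) :
    (∑ u : (ZMod f)ˣ, (((u : ZMod f).val : ℕ) : ℚ_[p]) * (χ (u : ZMod f))⁻¹) / (f : ℚ_[p]) =
      KrizLi2019.bernoulliOnePrim χ⁻¹ := by
  rw [bernoulliOnePrim_inv_eq_generalizedBernoulli hprim,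
    KrizLi2019.generalizedBernoulli_one_eq_sum_div χ⁻¹ (inv_ne_one.mpr hχ1)]
  congr 1
  rw [sum_eq_sum_units (fun j : ZMod f => χ⁻¹ j * ((j.val : ℕ) : ℚ_[p]))
    (fun j hj => by rw [MulChar.map_nonunit _ hj, zero_mul])]
  exact Finset.sum_congr rfl fun u _ => by rw [MulChar.inv_apply_eq_inv', mul_comm]

end BernoulliForm


/-! ### The dictionary: from `ψ(τ̄) = χ(χ_f(τ))` on `Γ_ℚ` to `K₁ = K^{ker ψ} ↪ ℚ(μ_f)` -/

section Dictionary

open Literature.NumberTheory.GaloisRepresentations Field _root_.NumberField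

variable {K : Type} [Field K] [NumberField K] [IsAbelianGalois ℚ K] {f : ℕ} [NeZero f]

/-- If `τ ∈ Γ_ℚ` fixes the copy of `ℚ(μ_f)` in `ℚ̄`, then `χ_f(τ) = 1`. [folklore] -/
private theorem modNCyclotomicCharacter_eq_one_of_forall_smul (M : Type) [Field M] [NumberField M]
    [IsCyclotomicExtension {f} ℚ M] (τ : absoluteGaloisGroup ℚ)
    (hτ : ∀ y : M, τ • absEmbedding ℚ M y = absEmbedding ℚ M y) :
    modNCyclotomicCharacter ℚ f τ = 1 := by
  have hζ : IsPrimitiveRoot (absEmbedding ℚ M (IsCyclotomicExtension.zeta f ℚ M)) f :=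
    (IsCyclotomicExtension.zeta_spec f ℚ M).map_of_injective (absEmbedding ℚ M).injective
  ext
  rw [Units.val_one, ← Nat.cast_one]
  exact modNCyclotomicCharacter_eq_of_smul_eq_pow ℚ f hζ τ (by rw [pow_one]; exact hτ _)

/-- Galois correspondence for `F̄/F` (characteristic `0`): an element fixed by `Gal(F̄/L)` lies in `L`.
[folklore] -/
private theorem mem_of_forall_mem_fixingSubgroup {F : Type*} [Field F] [CharZero F]
    (L : IntermediateField F (AlgebraicClosure F)) {x : AlgebraicClosure F}
    (hx : ∀ τ ∈ L.fixingSubgroup, τ x = x) : x ∈ L := by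
  haveI : IsGalois F (AlgebraicClosure F) := {}
  rw [← InfiniteGalois.fixedField_fixingSubgroup L]
  exact (IntermediateField.mem_fixedField_iff _ x).mpr hx

/-- If `τ ∈ Γ_ℚ` fixes the copy of `ℚ(μ_f)` in `ℚ̄` and `ψ(τ̄) = χ(χ_f τ)` on `Γ_ℚ`, then `τ` fixes the copy of
`K^{ker ψ}`: `χ_f(τ) = 1`, so `ψ(τ̄) = χ(1) = 1` and `τ̄ ∈ ker ψ`. [folklore] -/
private theorem smul_absEmbedding_eq_of_forall_smul (M : Type) [Field M] [NumberField M]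
    [IsCyclotomicExtension {f} ℚ M] {p : ℕ} [Fact p.Prime] (ψ : (K ≃ₐ[ℚ] K) →* ℤ_[p]ˣ)
    (χ : DirichletCharacter ℚ_[p] f)
    (hψχ : ∀ τ : absoluteGaloisGroup ℚ,
      (((ψ (absGaloisQuot ℚ K τ) : ℤ_[p]ˣ) : ℤ_[p]) : ℚ_[p]) =
        χ ((modNCyclotomicCharacter ℚ f τ : (ZMod f)ˣ) : ZMod f))
    (τ : absoluteGaloisGroup ℚ) (hτ : ∀ y : M, τ • absEmbedding ℚ M y = absEmbedding ℚ M y)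
    {x : K} (hx : x ∈ IntermediateField.fixedField ψ.ker) :
    τ • absEmbedding ℚ K x = absEmbedding ℚ K x := by
  have h1 : modNCyclotomicCharacter ℚ f τ = 1 := modNCyclotomicCharacter_eq_one_of_forall_smul M τ hτ
  have hψ1 : ψ (absGaloisQuot ℚ K τ) = 1 := by
    have h := hψχ τ
    rw [h1, Units.val_one, map_one, ← PadicInt.coe_one] at h
    exact Units.ext (PadicInt.ext h)
  have hfix : absGaloisQuot ℚ K τ x = x :=
    (IntermediateField.mem_fixedField_iff _ x).mp hx _ ((MonoidHom.mem_ker).mpr hψ1)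
  rw [← absEmbedding_absGaloisQuot_apply, hfix]

/-- **`K^{ker ψ}` lies in `ℚ(μ_f)` inside `ℚ̄`** when `ψ(τ̄) = χ(χ_f τ)` on `Γ_ℚ` (Galois correspondence for
`ℚ̄/ℚ` applied to the previous lemma: Kronecker–Weber for the cyclic field of `ψ`, in the sharp form
«field of the character ⊆ ℚ(μ_{conductor})», read off the dictionary). [cite: Washington1997, Ch. 3 (the field belonging to a group of Dirichlet characters)] -/
theorem exists_absEmbedding_eq_of_mem_fixedField (M : Type) [Field M] [NumberField M]
    [IsCyclotomicExtension {f} ℚ M] {p : ℕ} [Fact p.Prime] (ψ : (K ≃ₐ[ℚ] K) →* ℤ_[p]ˣ)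
    (χ : DirichletCharacter ℚ_[p] f)
    (hψχ : ∀ τ : absoluteGaloisGroup ℚ,
      (((ψ (absGaloisQuot ℚ K τ) : ℤ_[p]ˣ) : ℤ_[p]) : ℚ_[p]) =
        χ ((modNCyclotomicCharacter ℚ f τ : (ZMod f)ˣ) : ZMod f))
    (x : K) (hx : x ∈ IntermediateField.fixedField ψ.ker) :
    ∃ y : M, absEmbedding ℚ M y = absEmbedding ℚ K x := by
  have hmem : absEmbedding ℚ K x ∈ (absEmbedding ℚ M).fieldRange := by
    refine mem_of_forall_mem_fixingSubgroup _ fun τ hτ => ?_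
    rw [IntermediateField.mem_fixingSubgroup_iff] at hτ
    have hτ' : ∀ y : M, (absoluteGaloisGroup.toAlgEquiv ℚ).symm τ • absEmbedding ℚ M y =
        absEmbedding ℚ M y := fun y => by
      rw [absoluteGaloisGroup.toAlgEquiv_symm_apply]
      exact hτ _ ⟨y, rfl⟩
    have := smul_absEmbedding_eq_of_forall_smul M ψ χ hψχ _ hτ' hx
    rwa [absoluteGaloisGroup.toAlgEquiv_symm_apply] at this
  obtain ⟨y, hy⟩ := hmem
  exact ⟨y, hy⟩

/-- **THE HERBRAND DIRECTION OF MAZUR–WILES' THEOREM 2, UNCONDITIONALLY (drop-in twin of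
`classGroupChiComponent_eq_bot_of_norm_bernoulli_eq_one` WITHOUT the hypothesis
`(h : MazurWiles1984.thm2_card_oddChiClassGroup_eq_bernoulli)`).** Let `p` be an odd prime, `K/ℚ` abelian with
`p ∤ [K:ℚ]`, `χ` a primitive odd `ℚ_p`-valued Dirichlet character mod `f` with «`χ ≠ ω`», `ψ : Gal(K/ℚ) → ℤ_pˣ`
with `ψ(τ̄) = χ(χ_f(τ))` for all `τ ∈ Γ_ℚ`. If `‖B_{1,χ⁻¹}‖_p = 1` then `e_ψ(ℤ_p ⊗ Cl K) = 0`. Proof: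
`K₁ = K^{ker ψ}` embeds in `M = ℚ(μ_f)` (`exists_absEmbedding_eq_of_mem_fixedField`); along the fibres of
`Gal(K/ℚ) → Gal(K₁/ℚ)` the character `ψ` is `χ ∘ c` (lift to `Γ_ℚ`, read `χ_f(τ) = c(τ|_M)` on `ζ_f ∈ ℚ̄`);
Stickelberger for `K ⊇ K₁ ⊆ ℚ(μ_f)` (`classGroupChiComponent_eq_bot_of_norm_bernoulliSum_eq_one`) with the unit
`(b − χ(b))·B_{1,χ⁻¹}` (`exists_unit_norm_natCast_sub_apply_eq_one`, `sum_units_val_mul_inv_div_eq_bernoulliOnePrim`).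
[cite: Lang1990, Ch. 1 §3 Thm. 3.1, Lemma 1, Cor. 3] [cite: Washington1997, Thm. 6.10, §6.3] [cite: Solomon1990, Rem. II.1 (a) p. 472] -/
theorem classGroupChiComponent_eq_bot_of_norm_bernoulli_eq_one_stickelberger {p : ℕ} [Fact p.Prime]
    (hp2 : p ≠ 2) (hpK : ¬ p ∣ Module.finrank ℚ K)
    {χ : DirichletCharacter ℚ_[p] f} (hprim : χ.IsPrimitive) (hodd : χ.Odd)
    (hχω : ¬ ∀ a : ℤ, ¬ ((p : ℤ) ∣ a) → ‖χ (a : ZMod f) - (a : ℚ_[p])‖ < 1)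
    {ψ : (K ≃ₐ[ℚ] K) →* ℤ_[p]ˣ}
    (hψχ : ∀ τ : absoluteGaloisGroup ℚ,
      (((ψ (absGaloisQuot ℚ K τ) : ℤ_[p]ˣ) : ℤ_[p]) : ℚ_[p]) =
        χ ((modNCyclotomicCharacter ℚ f τ : (ZMod f)ˣ) : ZMod f))
    (hB : ‖KrizLi2019.bernoulliOnePrim χ⁻¹‖ = 1) :
    classGroupChiComponent ℚ K p (fun σ => ((ψ σ : ℤ_[p]ˣ) : ℤ_[p])) = ⊥ := by
  -- the cyclotomic field `M = ℚ(μ_f)` and the subfield `K₁ = K^{ker ψ}`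
  let M : Type := CyclotomicField f ℚ
  haveI : IsCyclotomicExtension {f} ℚ M := by
    convert (CyclotomicField.isCyclotomicExtension f ℚ) using 1
    all_goals rfl
  haveI : NumberField M := by
    show NumberField (CyclotomicField f ℚ); infer_instance
  haveI : IsGalois ℚ M := IsCyclotomicExtension.isGalois {f} ℚ M
  let K₁ : IntermediateField ℚ K := IntermediateField.fixedField ψ.ker
  haveI : IsGalois ℚ K₁ := IsGalois.of_fixedField_normal_subgroup ψ.ker
  haveI : NumberField K₁ := NumberField.mk
  -- the embedding `i : K₁ → M` with `e_M ∘ i = e_K`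
  have hrange : ∀ x : K₁, ((absEmbedding ℚ K).comp K₁.val) x ∈ (absEmbedding ℚ M).range := fun x => by
    obtain ⟨y, hy⟩ := exists_absEmbedding_eq_of_mem_fixedField M ψ χ hψχ (x : K) x.2
    exact ⟨y, hy⟩
  let i : K₁ →ₐ[ℚ] M := (AlgEquiv.ofInjectiveField (absEmbedding ℚ M)).symm.toAlgHom.comp
    (((absEmbedding ℚ K).comp K₁.val).codRestrict (absEmbedding ℚ M).range hrange)
  have hi : ∀ x : K₁, absEmbedding ℚ M (i x) = absEmbedding ℚ K (x : K) := by
    intro x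
    have h1 : ((AlgEquiv.ofInjectiveField (absEmbedding ℚ M)) (i x) : AlgebraicClosure ℚ) =
        absEmbedding ℚ M (i x) := AlgEquiv.ofInjective_apply _ _ _
    rw [← h1]
    change (((AlgEquiv.ofInjectiveField (absEmbedding ℚ M))
      ((AlgEquiv.ofInjectiveField (absEmbedding ℚ M)).symm
        (((absEmbedding ℚ K).comp K₁.val).codRestrict (absEmbedding ℚ M).range hrange x)) :
          AlgebraicClosure ℚ)) = _
    rw [AlgEquiv.apply_symm_apply, AlgHom.coe_codRestrict]
    rfl
  letI : Algebra K₁ M := i.toRingHom.toAlgebra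
  haveI : IsScalarTower ℚ K₁ M := IsScalarTower.of_algebraMap_eq fun r => (i.commutes r).symm
  haveI : IsGalois K₁ M := IsGalois.tower_top_of_isGalois ℚ K₁ M
  -- restrictions of `τ ∈ Γ_ℚ` to `K₁` through `K` and through `M` agree
  have hres : ∀ τ : absoluteGaloisGroup ℚ,
      (absGaloisQuot ℚ K τ).restrictNormal K₁ = (absGaloisQuot ℚ M τ).restrictNormal K₁ := by
    intro τ
    refine AlgEquiv.ext fun x => ?_
    apply (absEmbedding ℚ K).injective.comp Subtype.val_injective
    change absEmbedding ℚ K ((((absGaloisQuot ℚ K τ).restrictNormal K₁ x : K₁) : K)) =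
      absEmbedding ℚ K ((((absGaloisQuot ℚ M τ).restrictNormal K₁ x : K₁) : K))
    have hK : (((absGaloisQuot ℚ K τ).restrictNormal K₁ x : K₁) : K) =
        absGaloisQuot ℚ K τ (x : K) := AlgEquiv.restrictNormal_commutes _ K₁ x
    have hM : algebraMap K₁ M ((absGaloisQuot ℚ M τ).restrictNormal K₁ x) =
        absGaloisQuot ℚ M τ (algebraMap K₁ M x) := AlgEquiv.restrictNormal_commutes _ K₁ x
    rw [hK, absEmbedding_absGaloisQuot_apply, ← hi, ← hi]
    change _ = absEmbedding ℚ M (algebraMap K₁ M ((absGaloisQuot ℚ M τ).restrictNormal K₁ x))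
    rw [hM, absEmbedding_absGaloisQuot_apply]
    rfl
  -- `ψ = χ ∘ c` along the fibres of `Gal(K/ℚ) → Gal(K₁/ℚ)`
  have hψχ' : ∀ (g : K ≃ₐ[ℚ] K) (σ : M ≃ₐ[ℚ] M), g.restrictNormal K₁ = σ.restrictNormal K₁ →
      (((ψ g : ℤ_[p]ˣ) : ℤ_[p]) : ℚ_[p]) =
        χ ((IsCyclotomicExtension.Rat.galEquivZMod f M σ : (ZMod f)ˣ) : ZMod f) := by
    intro g σ hgσ
    obtain ⟨τ, hτ⟩ := absGaloisQuot_surjective ℚ M σ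
    -- `χ_f(τ) = c(σ)`
    have hζ : IsPrimitiveRoot (absEmbedding ℚ M (IsCyclotomicExtension.zeta f ℚ M)) f :=
      (IsCyclotomicExtension.zeta_spec f ℚ M).map_of_injective (absEmbedding ℚ M).injective
    have hc : (modNCyclotomicCharacter ℚ f τ : ZMod f) =
        ((IsCyclotomicExtension.Rat.galEquivZMod f M σ : (ZMod f)ˣ) : ZMod f) := by
      have hsmul : τ • absEmbedding ℚ M (IsCyclotomicExtension.zeta f ℚ M) =
          absEmbedding ℚ M (IsCyclotomicExtension.zeta f ℚ M) ^
            ((IsCyclotomicExtension.Rat.galEquivZMod f M σ : (ZMod f)ˣ) : ZMod f).val := by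
        rw [← absEmbedding_absGaloisQuot_apply, hτ, ← map_pow,
          ← IsCyclotomicExtension.Rat.galEquivZMod_apply_of_pow_eq f M σ
            (IsCyclotomicExtension.zeta_spec f ℚ M).pow_eq_one]
      rw [modNCyclotomicCharacter_eq_of_smul_eq_pow ℚ f hζ τ hsmul, ZMod.natCast_zmod_val]
    -- `ψ g = ψ τ̄`: `g⁻¹ τ̄` restricts to `1` on `K₁`, hence fixes `K₁ = K^{ker ψ}`, hence lies in `ker ψ`
    have hθ1 : (g⁻¹ * absGaloisQuot ℚ K τ).restrictNormal K₁ = 1 := by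
      rw [show (g⁻¹ * absGaloisQuot ℚ K τ).restrictNormal K₁ =
          (g.restrictNormal K₁)⁻¹ * (absGaloisQuot ℚ K τ).restrictNormal K₁ from by
            change AlgEquiv.restrictNormalHom K₁ (g⁻¹ * absGaloisQuot ℚ K τ) =
              (AlgEquiv.restrictNormalHom K₁ g)⁻¹ * AlgEquiv.restrictNormalHom K₁ (absGaloisQuot ℚ K τ)
            rw [map_mul, map_inv],
        hres τ, hτ, hgσ, inv_mul_cancel]
    have hker : g⁻¹ * absGaloisQuot ℚ K τ ∈ ψ.ker := by
      rw [← IntermediateField.fixingSubgroup_fixedField ψ.ker]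
      rw [IntermediateField.mem_fixingSubgroup_iff]
      intro x hx
      have := AlgEquiv.restrictNormal_commutes (g⁻¹ * absGaloisQuot ℚ K τ) K₁ ⟨x, hx⟩
      rw [hθ1, AlgEquiv.one_apply] at this
      exact this.symm
    have hψg : ψ g = ψ (absGaloisQuot ℚ K τ) := by
      have := (MonoidHom.mem_ker).mp hker
      rw [map_mul, map_inv, inv_mul_eq_one] at this
      exact this
    rw [hψg, hψχ τ, hc]
  -- the unit `b` and the Bernoulli sum
  obtain ⟨b, hb, hbu, hbχ⟩ := exists_unit_norm_natCast_sub_apply_eq_one hp2 hprim hodd hχω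
  have hχ1 : χ ≠ 1 := by
    intro h
    have h1 : χ (-1) = -1 := hodd
    rw [h, show (-1 : ZMod f) = ((-1 : (ZMod f)ˣ) : ZMod f) by rw [Units.val_neg, Units.val_one],
      MulChar.one_apply_coe] at h1
    norm_num at h1
  have hB' : ‖(∑ u : (ZMod f)ˣ, (((u : ZMod f).val : ℕ) : ℚ_[p]) * (χ (u : ZMod f))⁻¹) / (f : ℚ_[p])‖ = 1 := by
    rw [sum_units_val_mul_inv_div_eq_bernoulliOnePrim hprim hχ1]; exact hB
  exact classGroupChiComponent_eq_bot_of_norm_bernoulliSum_eq_one (K₁ := K₁) (M := M) hpK ψ χ hψχ' hb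
    hbu hbχ hB'

end Dictionary

/-! ### Appendix (same session): the «`χ ≠ ω`» hypothesis in the form `¬ (f = p ∧ ∀ a, …)` of the second typing of Mazur–Wiles' Thm. 2 -/

section OmegaForm

open Literature.NumberTheory.GaloisRepresentations Field

variable {p : ℕ} [hp : Fact p.Prime] {f : ℕ} [NeZero f]

/-- **If every unit `u` mod `f` has `χ(u) ≡ u (mod p)` (and `p ∣ f`), then `f = p`** (`p` odd, `χ` primitive and
odd): the units `u ≡ 1 (mod p)` have `χ(u) ≡ 1`, hence `χ(u) = 1` (roots of unity of `ℚ_p` congruent to `1` are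
trivial), so `χ` factors through `p` and primitivity gives `f = p` — Lang's Lemma 1 read backwards.
[cite: Lang1990, Ch. 1 §3 Lemma 1] -/
theorem level_eq_prime_of_forall_units_norm_sub_lt_one (hp2 : p ≠ 2) {χ : DirichletCharacter ℚ_[p] f}
    (hprim : χ.IsPrimitive) (hodd : χ.Odd) (hpf : p ∣ f)
    (hlt : ∀ u : (ZMod f)ˣ, ‖(((u : ZMod f).val : ℕ) : ℚ_[p]) - χ (u : ZMod f)‖ < 1) : f = p := by
  have hf1 : f ≠ 1 := level_ne_one_of_odd hodd
  have hfpos : 0 < f := NeZero.pos f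
  -- units `≡ 1 (mod p)` have `χ(u) = 1`
  have hker : (ZMod.unitsMap hpf).ker ≤ χ.toUnitHom.ker := by
    intro u hu
    rw [MonoidHom.mem_ker] at hu ⊢
    have hval : (((u : ZMod f).val : ℕ) : ZMod p) = 1 := by
      have := congrArg (fun x : (ZMod p)ˣ => (x : ZMod p)) hu
      simp only [ZMod.unitsMap_val, Units.val_one, ZMod.cast_eq_val] at this
      exact this
    have h1 : ‖(((u : ZMod f).val : ℕ) : ℚ_[p]) - 1‖ < 1 := by
      have hdvd : (p : ℤ) ∣ (((u : ZMod f).val : ℕ) : ℤ) - 1 := by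
        rw [← ZMod.intCast_zmod_eq_zero_iff_dvd]
        push_cast
        rw [hval, sub_self]
      have := Padic.norm_intCast_lt_one_iff (p := p) |>.mpr hdvd
      push_cast at this
      exact this
    have hχ1 : ‖χ (u : ZMod f) - 1‖ < 1 := by
      have : χ (u : ZMod f) - 1 = (χ (u : ZMod f) - (((u : ZMod f).val : ℕ) : ℚ_[p])) +
          ((((u : ZMod f).val : ℕ) : ℚ_[p]) - 1) := by ring
      rw [this]
      refine lt_of_le_of_lt (IsUltrametricDist.norm_add_le_max _ _) (max_lt ?_ h1)
      rw [← norm_neg, neg_sub]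
      exact hlt u
    have hroot := eq_one_of_pow_eq_one_of_norm_sub_one_lt hp2 (Nat.totient_pos.mpr hfpos)
      (pow_totient_apply_eq_one χ u) hχ1
    exact Units.ext (by rw [MulChar.coe_toUnitHom]; exact hroot)
  have hfac : χ.FactorsThrough p := (DirichletCharacter.factorsThrough_iff_ker_unitsMap hpf).mpr hker
  have hdvd : χ.conductor ∣ p := DirichletCharacter.conductor_dvd_of_mem_conductorSet χ hfac
  rw [hprim] at hdvd
  exact ((Nat.dvd_prime hp.out).mp hdvd).resolve_left hf1

/-- **The two spellings of «`χ ≠ ω`» agree for primitive odd `χ` and odd `p`**: the second typing's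
`¬ (f = p ∧ ∀ a, p ∤ a → ‖χ(a) − a‖ < 1)` implies the first typing's `¬ ∀ a, p ∤ a → ‖χ(a) − a‖ < 1`
(if all `a` prime to `p` satisfied the congruence then, for `p ∤ f`, `a = 1 ± f` would violate it
(`not_forall_norm_sub_lt_one_of_not_dvd`), and for `p ∣ f` every unit is such an `a`, so `f = p`).
[cite: Solomon1990, §I p. 468 («χ ≠ ω (the Teichmüller character)»)] [cite: Lang1990, Ch. 1 §3 Lemma 1] -/
theorem not_forall_norm_sub_lt_one_of_not_and (hp2 : p ≠ 2) {χ : DirichletCharacter ℚ_[p] f}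
    (hprim : χ.IsPrimitive) (hodd : χ.Odd)
    (hω : ¬ (f = p ∧ ∀ a : ℤ, ¬ ((p : ℤ) ∣ a) → ‖χ (a : ZMod f) - (a : ℚ_[p])‖ < 1)) :
    ¬ ∀ a : ℤ, ¬ ((p : ℤ) ∣ a) → ‖χ (a : ZMod f) - (a : ℚ_[p])‖ < 1 := by
  intro hT
  by_cases hpf : p ∣ f
  · refine hω ⟨level_eq_prime_of_forall_units_norm_sub_lt_one hp2 hprim hodd hpf fun u => ?_, hT⟩
    have hpu : ¬ ((p : ℤ) ∣ (((u : ZMod f).val : ℕ) : ℤ)) := by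
      intro h
      have hcop := ZMod.val_coe_unit_coprime u
      have hpdvd : p ∣ (u : ZMod f).val := by exact_mod_cast h
      have : p ∣ Nat.gcd (u : ZMod f).val f := Nat.dvd_gcd hpdvd hpf
      rw [hcop] at this
      exact hp.out.one_lt.ne' (Nat.dvd_one.mp this)
    have h := hT _ hpu
    push_cast at h
    rw [ZMod.natCast_zmod_val] at h
    rw [← norm_neg, neg_sub]
    exact h
  · exact not_forall_norm_sub_lt_one_of_not_dvd hp2 χ hpf hT

variable {K : Type} [Field K] [NumberField K] [IsAbelianGalois ℚ K]

/-- **The drop-in with «`χ ≠ ω`» spelled as in the second typing of Mazur–Wiles' Thm. 2**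
(`¬ (f = p ∧ ∀ a, …)`): same conclusion `e_ψ(ℤ_p ⊗ Cl K) = 0`.
[cite: Lang1990, Ch. 1 §3 Thm. 3.1 and Cor. 3] [cite: Washington1997, Thm. 6.10] -/
theorem classGroupChiComponent_eq_bot_of_norm_bernoulli_eq_one_stickelberger' (hp2 : p ≠ 2)
    (hpK : ¬ p ∣ Module.finrank ℚ K)
    {χ : DirichletCharacter ℚ_[p] f} (hprim : χ.IsPrimitive) (hodd : χ.Odd)
    (hω : ¬ (f = p ∧ ∀ a : ℤ, ¬ ((p : ℤ) ∣ a) → ‖χ (a : ZMod f) - (a : ℚ_[p])‖ < 1))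
    {ψ : (K ≃ₐ[ℚ] K) →* ℤ_[p]ˣ}
    (hψχ : ∀ τ : absoluteGaloisGroup ℚ,
      (((ψ (absGaloisQuot ℚ K τ) : ℤ_[p]ˣ) : ℤ_[p]) : ℚ_[p]) =
        χ ((modNCyclotomicCharacter ℚ f τ : (ZMod f)ˣ) : ZMod f))
    (hB : ‖KrizLi2019.bernoulliOnePrim χ⁻¹‖ = 1) :
    classGroupChiComponent ℚ K p (fun σ => ((ψ σ : ℤ_[p]ˣ) : ℤ_[p])) = ⊥ :=
  classGroupChiComponent_eq_bot_of_norm_bernoulli_eq_one_stickelberger hp2 hpK hprim hodd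
    (not_forall_norm_sub_lt_one_of_not_and hp2 hprim hodd hω) hψχ hB

end OmegaForm

end Literature.NumberTheory.NumberFields.HerbrandStickelberger
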